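import Literature.MathematicalPhysics.QuantumLattice.DWaveSourceNNNHoppingFlatTwist
import Literature.MathematicalPhysics.QuantumLattice.DWaveSourceNNNHoppingOrderParameter
import HarnessLib

/-!
# The sourced helicity chord of the flat-twisted pair-sourced `t–t'` torus is bounded by the sourced gain

Topic `Literature/MathematicalPhysics/QuantumLattice` (namespace = path; family `hubbard`). Sequel of
`DWaveSourceNNNHoppingFlatTwist.lean` (the flat-twisted sourced torus `dWaveSourceTorusTT'Twist L t' U μ h n` is
unitarily the untwisted torus with the SPIRAL pair source, `groundEnergy_dWaveSourceTorusTT'Twist`; at `h = 0` the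
twist is invisible, `groundEnergy_dWaveSourceTorusTT'Twist_zero_source`) and `DWaveSourceNNNHoppingOrderParameter.lean`
(the source never raises the energy: the tracial ground-state functional of the `N`-conserving `t–t'` torus kills every
bond pair, `groundStateFunctional_hamiltonianWith_add_hamiltonian_bondPair`). For the Hubbard cuprate cell's row T8
(`sourced-helicity-chord`, `hubbard-cq`): the two hypotheses `gauge0` and `varq` of obst-1's bookkeeping sketch become
theorems about the finite torus, and with them its headline «the helicity chord never exceeds the sourced gain».

* `groundStateFunctional_hubbardTorusTT'_sub_mu_spiralPairField`: `ω₀[H^{tt'} − μN](Δ_g^{(2n)}) = 0` — no spiral pair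
  amplitude without a source either;
* `groundEnergy_spiralSourced_le`: `E₀((H^{tt'} − μN) − h(Δ^{(2n)} + Δ^{(2n)†})) ≤ E₀(H^{tt'} − μN)` (variational
  principle with the source-free ground state);
* **`groundEnergy_dWaveSourceTorusTT'Twist_le_zero_source`** (`varq`): `E₀(twist n, h) ≤ E₀(dWaveSourceTorusTT' L t' U μ 0)`;
* **`sourcedHelicityChord_le_sourcedGain`**: `E₀(twist n, h) − E₀(A_L(h)) ≤ E₀(A_L(0)) − E₀(A_L(h))`,
  `A_L(h) = dWaveSourceTorusTT' L t' U μ h` — the finite-torus form of `helicityChord_le_gain` (`L ≥ 3`).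

HONEST SCOPE: finite-volume inequalities between grand-canonical ground energies; no number, no thermodynamic limit,
nothing about superconductivity. Everything is PROVED; no definition.

## References
* T. Koma, H. Tasaki, J. Stat. Phys. 76 (1994) 745–803, §1 (the source term has zero expectation in a
  symmetric ground state; variational principle). [cite: KomaTasaki1994, §1]
* H. Watanabe, J. Stat. Phys. 177 (2019) 717, §2.2.1. [cite: Watanabe2019, §2.2.1]
-/

noncomputable section

namespace Literature.MathematicalPhysics.QuantumLattice

open _root_.Matrix Finset Literature.Probability.LatticeModels HubbardWave0
open scoped ComplexConjugate

variable (L : ℕ) [NeZero L]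

/-- **No spiral pair amplitude without a source**: `ω₀[H^{tt'}(1,t',U) − μN](Δ_g^{(2n)}) = 0` for every form factor `g`
and every twist label `n` (the source-free `t–t'` torus conserves the particle number; each bond pair has zero
tracial ground-state expectation). [cite: KomaTasaki1994, §1] -/
theorem groundStateFunctional_hubbardTorusTT'_sub_mu_spiralPairField (t' U μ : ℝ) (g : Site 2 → ℝ)
    (n : Fin 2 → ZMod L) :
    (hubbardTorusTT' L 1 t' U - (μ : ℂ) • totalNumber).groundStateFunctional (spiralPairField L g n) = 0 := by
  rw [hubbardTorusTT'_sub_mu_eq, spiralPairField, map_sum]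
  refine Finset.sum_eq_zero fun x _ => ?_
  rw [map_smul, smul_eq_zero]
  right
  rw [spiralLocalPair, map_sum]
  refine Finset.sum_eq_zero fun e _ => ?_
  rw [LinearMap.map_smul_of_tower, smul_eq_zero]
  right
  rw [map_smul, smul_eq_zero]
  right
  -- `convert` closes the `DecidableEq`-instance mismatch on `Finset (Orb (FermionTorus 2 L))` by subsingleton
  have h0 := groundStateFunctional_hamiltonianWith_add_hamiltonian_bondPair (fermionTorusGraph 2 L)
    (fermionTorusDiagGraph L) 1 U μ t' 0 (FermionTorus.ofTorusSite x) (FermionTorus.ofTorusSite (x + Torus.proj L e))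
  convert h0 using 4
  rfl

/-- **The spiral source never raises the energy**: `E₀((H^{tt'} − μN) − h(Δ^{(2n)} + Δ^{(2n)†})) ≤ E₀(H^{tt'} − μN)`,
every real `h` (variational principle with a source-free ground state, whose spiral pair amplitude vanishes).
[cite: KomaTasaki1994, §1] -/
theorem groundEnergy_spiralSourced_le (t' U μ h : ℝ) (g : Site 2 → ℝ) (n : Fin 2 → ZMod L) :
    ((hubbardTorusTT' L 1 t' U - (μ : ℂ) • totalNumber) -
        (h : ℂ) • (spiralPairField L g n + (spiralPairField L g n)ᴴ)).groundEnergy ≤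
      (hubbardTorusTT' L 1 t' U - (μ : ℂ) • totalNumber).groundEnergy := by
  have h0 : ((hubbardTorusTT' L 1 t' U - (μ : ℂ) • totalNumber).groundStateFunctional
      (spiralPairField L g n + (spiralPairField L g n)ᴴ)).re = 0 := by
    rw [map_add, Complex.add_re, groundStateFunctional_conjTranspose_re,
      groundStateFunctional_hubbardTorusTT'_sub_mu_spiralPairField]
    simp
  exact groundEnergy_source_le_of_re_eq_zero (isHermitian_hubbardTorusTT'_sub_smul_totalNumber L t' U μ)
    (Matrix.isHermitian_add_transpose_self _) h0 h

/-- **`varq` as a theorem** (`L ≥ 3`): the flat-twisted pair-sourced torus never lies above the source-free torus,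
`E₀(dWaveSourceTorusTT'Twist L t' U μ h n) ≤ E₀(dWaveSourceTorusTT' L t' U μ 0)`. [cite: KomaTasaki1994, §1] -/
theorem groundEnergy_dWaveSourceTorusTT'Twist_le_zero_source (hL : 3 ≤ L) (t' U μ h : ℝ) (n : Fin 2 → ZMod L) :
    (dWaveSourceTorusTT'Twist L t' U μ h n).groundEnergy ≤ (dWaveSourceTorusTT' L t' U μ 0).groundEnergy := by
  rw [groundEnergy_dWaveSourceTorusTT'Twist L hL, dWaveSourceTorusTT'_zero_source]
  exact groundEnergy_spiralSourced_le L t' U μ h dWaveFormFactor n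

/-- **THE HELICITY CHORD NEVER EXCEEDS THE SOURCED GAIN** (`L ≥ 3`; the finite-torus form of the bookkeeping lemma
`helicityChord_le_gain` with both its hypotheses discharged):
`E₀(twist n, h) − E₀(A_L(h)) ≤ E₀(A_L(0)) − E₀(A_L(h))`, `A_L(h) = dWaveSourceTorusTT' L t' U μ h`.
[cite: KomaTasaki1994, §1] -/
theorem sourcedHelicityChord_le_sourcedGain (hL : 3 ≤ L) (t' U μ h : ℝ) (n : Fin 2 → ZMod L) :
    (dWaveSourceTorusTT'Twist L t' U μ h n).groundEnergy - (dWaveSourceTorusTT' L t' U μ h).groundEnergy ≤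
      (dWaveSourceTorusTT' L t' U μ 0).groundEnergy - (dWaveSourceTorusTT' L t' U μ h).groundEnergy :=
  sub_le_sub_right (groundEnergy_dWaveSourceTorusTT'Twist_le_zero_source L hL t' U μ h n) _

/-- The gain itself is non-negative: `E₀(A_L(h)) ≤ E₀(A_L(0))` (the tree's `groundEnergy_dWaveSourceTorusTT'_le`), so the
chord bound is a bound by a non-negative certified number. [cite: KomaTasaki1994, §1] -/
theorem sourcedGain_nonneg (t' U μ h : ℝ) :
    0 ≤ (dWaveSourceTorusTT' L t' U μ 0).groundEnergy - (dWaveSourceTorusTT' L t' U μ h).groundEnergy :=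
  sub_nonneg.2 (groundEnergy_dWaveSourceTorusTT'_le (L := L) t' U μ h)

end Literature.MathematicalPhysics.QuantumLattice
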